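import Summits.CriticalPhenomena.CardyFormulaZ2.Theorems.CardyGluingRDEBoxMergingSquareCardy
import Literature.Probability.LatticeModels.FKTwoArcPartitionPolynomials

/-!
# `CardyGluingRDE.BoxMerging`: crossings between unions of boundary segments are read from the
# state law (stmt-CriticalPhenomena-8582)

Companion of `CardyGluingRDEBoxMergingSquareCardy.lean`.  The route item `BoxMerging`
(sub-problem `CardyFormulaZ2`, route `CardyGluingRDE`) controls the total variation `TV_j(u,u')`
between the bond-`ℤ²` and site-`𝕋` laws of the resolution-`j` segment-connectivity matrix of the
square window.  Downstream (item `MergingGivesPolygonCardy`, step (i): "discreteArc of a union of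
boundary segments is the union of their discreteArcs (infDist bookkeeping), so the crossing
probability is a function of the law of the boundary-segment matrix") one needs crossing events
between UNIONS of segments — the arcs of a dyadic-marked square are such unions.  This file
supplies that bookkeeping on both lattices and the resulting transfer:

* `BoxMerging_arcLike_union`, `BoxMerging_arcLike_biUnion` — for any "closest-boundary-piece"
  selector `{x ∈ S | infDist (f x) A ≤ infDist (f x) (F \ A)}` (the shape of both `discreteArc`
  and `triDiscreteArc`), the selector of a finite union of nonempty pieces leaving out a nonempty
  part of `F` is the union of the selectors (Smirnov 2001, §2; the binary bond case is the tree's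
  `discreteArc_union`).
* `BoxMerging_discreteCrossing_biUnion`, `BoxMerging_triCrossing_biUnion` — hence the G02
  crossing event between two finite unions of boundary pieces is the union of the crossing
  events between the pieces, on `ℤ²` and on `𝕋`.
* `BoxMerging_biUnion_stateEvent_exists` — that union is read from the state: it is the union of
  the state events `{ω | ∀ a b, ω ∈ C a b ↔ M a b}` over the matrices `M` with an entry `true` in
  `I × J`.
* `BoxMerging_abs_bond_sub_tri_le_of_biUnion` — **transfer**: for a bounded window, a finite
  family `A` of nonempty boundary pieces and index sets `I, J`,
  `|P_ℤ²[⋃_I A ↔ ⋃_J A in Ω_u] - P_𝕋[⋃_I A ↔ ⋃_J A in Ω_u']| ≤ Σ_M |P_ℤ²[E_Z M] - P_𝕋[E_T M]|`.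

The square-specific consequences of `BoxMerging` (merging of the crossing probabilities between
any two proper unions of dyadic segments) are in `CardyGluingRDEBoxMergingDyadicSquare.lean`.
-/

noncomputable section

namespace Summit.CriticalPhenomena.CardyFormulaZ2.Theorems

open scoped BigOperators Topology
open Filter Set MeasureTheory
open Literature.Probability.Percolation Literature.Probability.RandomPlanarGeometry
  Literature.Probability.LatticeModels
open Summit.CriticalPhenomena.CardyFormulaZ2.Theses.CardyGluingRDE

/-! ### Closest-piece selectors of unions -/

/-- **A closest-piece selector of a union is the union of the selectors.**  For a map
`f : X → α` into a metric space, a base set `S ⊆ X`, a "boundary" `F ⊆ α` and nonempty pieces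
`A, B` with `F \ (A ∪ B)` nonempty: a point of `S` is at least as close to `A ∪ B` as to
`F \ (A ∪ B)` iff it is so for `A` or for `B` (with `F \ A`, `F \ B`).  Both `discreteArc`
(`f = meshPoint δ`, `S = meshBoundary Ω δ`) and `triDiscreteArc` (`f = triMeshPoint δ`,
`S = triMeshBoundary Ω δ`) are of this shape; the bond instance is the tree's `discreteArc_union`.
[cite: Smirnov2001, §2] -/
theorem BoxMerging_arcLike_union {X α : Type*} [PseudoMetricSpace α] (S : Set X) (f : X → α)
    (F : Set α) {A B : Set α} (hA : A.Nonempty) (hB : B.Nonempty) (hF : (F \ (A ∪ B)).Nonempty) :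
    {x ∈ S | Metric.infDist (f x) (A ∪ B) ≤ Metric.infDist (f x) (F \ (A ∪ B))} =
      {x ∈ S | Metric.infDist (f x) A ≤ Metric.infDist (f x) (F \ A)} ∪
        {x ∈ S | Metric.infDist (f x) B ≤ Metric.infDist (f x) (F \ B)} := by
  ext x
  simp only [mem_union, mem_setOf_eq]
  set z := f x
  have hU : Metric.infDist z (A ∪ B) = min (Metric.infDist z A) (Metric.infDist z B) :=
    infDist_union z hA hB
  have hsA : F \ (A ∪ B) ⊆ F \ A := Set.sdiff_subset_sdiff_right subset_union_left
  have hsB : F \ (A ∪ B) ⊆ F \ B := Set.sdiff_subset_sdiff_right subset_union_right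
  have hFA : Metric.infDist z (F \ A) ≤ Metric.infDist z (F \ (A ∪ B)) :=
    Metric.infDist_le_infDist_of_subset hsA hF
  have hFB : Metric.infDist z (F \ B) ≤ Metric.infDist z (F \ (A ∪ B)) :=
    Metric.infDist_le_infDist_of_subset hsB hF
  have hFA' : min (Metric.infDist z B) (Metric.infDist z (F \ (A ∪ B))) ≤
      Metric.infDist z (F \ A) := by
    rw [← infDist_union z hB hF]
    refine Metric.infDist_le_infDist_of_subset (fun y hy => ?_) (hF.mono hsA)
    by_cases hyB : y ∈ B
    · exact Or.inl hyB
    · exact Or.inr ⟨hy.1, fun h => h.elim hy.2 hyB⟩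
  have hFB' : min (Metric.infDist z A) (Metric.infDist z (F \ (A ∪ B))) ≤
      Metric.infDist z (F \ B) := by
    rw [← infDist_union z hA hF]
    refine Metric.infDist_le_infDist_of_subset (fun y hy => ?_) (hF.mono hsB)
    by_cases hyA : y ∈ A
    · exact Or.inl hyA
    · exact Or.inr ⟨hy.1, fun h => h.elim hyA hy.2⟩
  constructor
  · rintro ⟨hx, h⟩
    rw [hU] at h
    rcases le_total (Metric.infDist z A) (Metric.infDist z B) with hab | hab
    · rw [min_eq_left hab] at h
      exact Or.inl ⟨hx, (le_min hab h).trans hFA'⟩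
    · rw [min_eq_right hab] at h
      exact Or.inr ⟨hx, (le_min hab h).trans hFB'⟩
  · rintro (⟨hx, h⟩ | ⟨hx, h⟩)
    · exact ⟨hx, hU ▸ (min_le_left _ _).trans (h.trans hFA)⟩
    · exact ⟨hx, hU ▸ (min_le_right _ _).trans (h.trans hFB)⟩

/-- **Finite unions.**  An operator `arc` on pieces satisfying the binary union law of
`BoxMerging_arcLike_union` (under nonemptiness of the pieces and of the left-out part of `F`)
satisfies it for finite nonempty unions. [folklore] -/
theorem BoxMerging_arcLike_biUnion {X α ι : Type*} (arc : Set α → Set X) (F : Set α)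
    (harc : ∀ A B : Set α, A.Nonempty → B.Nonempty → (F \ (A ∪ B)).Nonempty →
      arc (A ∪ B) = arc A ∪ arc B)
    {s : Finset ι} (hs : s.Nonempty) (A : ι → Set α) (hA : ∀ i ∈ s, (A i).Nonempty)
    (hF : (F \ ⋃ i ∈ s, A i).Nonempty) :
    arc (⋃ i ∈ s, A i) = ⋃ i ∈ s, arc (A i) := by
  classical
  induction s using Finset.induction_on with
  | empty => exact absurd hs Finset.not_nonempty_empty
  | @insert a s ha ih =>
    rcases s.eq_empty_or_nonempty with rfl | hs'
    · simp
    · rw [Finset.set_biUnion_insert, Finset.set_biUnion_insert]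
      rw [Finset.set_biUnion_insert] at hF
      have hU : (⋃ i ∈ s, A i).Nonempty := by
        obtain ⟨i, hi⟩ := hs'
        exact (hA i (Finset.mem_insert_of_mem hi)).mono
          (subset_iUnion₂ (s := fun i (_ : i ∈ s) => A i) i hi)
      rw [harc _ _ (hA a (Finset.mem_insert_self a s)) hU hF,
        ih hs' (fun i hi => hA i (Finset.mem_insert_of_mem hi))
          (hF.mono (Set.sdiff_subset_sdiff_right subset_union_right))]

/-- The discrete arc (bond-`ℤ²` discretisation) of a finite nonempty union of nonempty boundary
pieces leaving out a nonempty part of `∂Ω` is the union of the discrete arcs.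
[cite: Smirnov2001, §2] -/
theorem BoxMerging_discreteArc_biUnion {Ω : Set ℂ} {δ : ℝ} {ι : Type*} {s : Finset ι}
    (hs : s.Nonempty) (A : ι → Set ℂ) (hA : ∀ i ∈ s, (A i).Nonempty)
    (hF : (frontier Ω \ ⋃ i ∈ s, A i).Nonempty) :
    discreteArc Ω δ (⋃ i ∈ s, A i) = ⋃ i ∈ s, discreteArc Ω δ (A i) :=
  BoxMerging_arcLike_biUnion (discreteArc Ω δ) (frontier Ω)
    (fun _ _ hA hB hF => discreteArc_union hA hB hF) hs A hA hF

/-- The discrete arc (site-`𝕋` discretisation) of a union of two nonempty boundary pieces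
leaving out a nonempty part of `∂Ω` is the union of the discrete arcs.
[cite: Smirnov2001, §2] -/
theorem BoxMerging_triDiscreteArc_union {Ω : Set ℂ} {δ : ℝ} {A B : Set ℂ} (hA : A.Nonempty)
    (hB : B.Nonempty) (hF : (frontier Ω \ (A ∪ B)).Nonempty) :
    triDiscreteArc Ω δ (A ∪ B) = triDiscreteArc Ω δ A ∪ triDiscreteArc Ω δ B :=
  BoxMerging_arcLike_union (triMeshBoundary Ω δ) (triMeshPoint δ) (frontier Ω) hA hB hF

/-- The discrete arc (site-`𝕋` discretisation) of a finite nonempty union of nonempty boundary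
pieces leaving out a nonempty part of `∂Ω` is the union of the discrete arcs.
[cite: Smirnov2001, §2] -/
theorem BoxMerging_triDiscreteArc_biUnion {Ω : Set ℂ} {δ : ℝ} {ι : Type*} {s : Finset ι}
    (hs : s.Nonempty) (A : ι → Set ℂ) (hA : ∀ i ∈ s, (A i).Nonempty)
    (hF : (frontier Ω \ ⋃ i ∈ s, A i).Nonempty) :
    triDiscreteArc Ω δ (⋃ i ∈ s, A i) = ⋃ i ∈ s, triDiscreteArc Ω δ (A i) :=
  BoxMerging_arcLike_biUnion (triDiscreteArc Ω δ) (frontier Ω)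
    (fun _ _ hA hB hF => BoxMerging_triDiscreteArc_union hA hB hF) hs A hA hF

/-! ### Crossing events between unions of pieces -/

/-- **Bond-`ℤ²`: a crossing between two unions of boundary pieces is a crossing between two of
the pieces.** [cite: Smirnov2001, §2] -/
theorem BoxMerging_discreteCrossing_biUnion {Ω : Set ℂ} {δ : ℝ} {κ : Type*} (A : κ → Set ℂ)
    {I J : Finset κ} (hI : I.Nonempty) (hJ : J.Nonempty) (hA : ∀ a, (A a).Nonempty)
    (hFI : (frontier Ω \ ⋃ a ∈ I, A a).Nonempty) (hFJ : (frontier Ω \ ⋃ b ∈ J, A b).Nonempty) :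
    discreteCrossing Ω δ (⋃ a ∈ I, A a) (⋃ b ∈ J, A b) =
      ⋃ a ∈ I, ⋃ b ∈ J, discreteCrossing Ω δ (A a) (A b) := by
  have h1 := BoxMerging_discreteArc_biUnion (Ω := Ω) (δ := δ) hI A (fun a _ => hA a) hFI
  have h2 := BoxMerging_discreteArc_biUnion (Ω := Ω) (δ := δ) hJ A (fun b _ => hA b) hFJ
  ext ω
  simp only [mem_discreteCrossing_iff, h1, h2, mem_iUnion, exists_prop]
  constructor
  · rintro ⟨x, ⟨a, ha, hx⟩, y, ⟨b, hb, hy⟩, hr⟩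
    exact ⟨a, ha, b, hb, x, hx, y, hy, hr⟩
  · rintro ⟨a, ha, b, hb, x, hx, y, hy, hr⟩
    exact ⟨x, ⟨a, ha, hx⟩, y, ⟨b, hb, hy⟩, hr⟩

/-- **Site-`𝕋`: a crossing between two unions of boundary pieces is a crossing between two of
the pieces.** [cite: Smirnov2001, §2] -/
theorem BoxMerging_triCrossing_biUnion {Ω : Set ℂ} {δ : ℝ} {κ : Type*} (A : κ → Set ℂ)
    {I J : Finset κ} (hI : I.Nonempty) (hJ : J.Nonempty) (hA : ∀ a, (A a).Nonempty)
    (hFI : (frontier Ω \ ⋃ a ∈ I, A a).Nonempty) (hFJ : (frontier Ω \ ⋃ b ∈ J, A b).Nonempty) :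
    triCrossing Ω δ (⋃ a ∈ I, A a) (⋃ b ∈ J, A b) =
      ⋃ a ∈ I, ⋃ b ∈ J, triCrossing Ω δ (A a) (A b) := by
  have h1 := BoxMerging_triDiscreteArc_biUnion (Ω := Ω) (δ := δ) hI A (fun a _ => hA a) hFI
  have h2 := BoxMerging_triDiscreteArc_biUnion (Ω := Ω) (δ := δ) hJ A (fun b _ => hA b) hFJ
  ext ω
  simp only [triCrossing, mem_setOf_eq, h1, h2, mem_iUnion, exists_prop]
  constructor
  · rintro ⟨x, ⟨a, ha, hx⟩, y, ⟨b, hb, hy⟩, hr⟩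
    exact ⟨a, ha, b, hb, x, hx, y, hy, hr⟩
  · rintro ⟨a, ha, b, hb, x, hx, y, hy, hr⟩
    exact ⟨x, ⟨a, ha, hx⟩, y, ⟨b, hb, hy⟩, hr⟩

/-! ### Reading unions of crossing events from the state -/

/-- The union of the events `C a b` over `(a, b) ∈ I × J` is the union of the state events over
the matrices having an entry `true` in `I × J`. [folklore] -/
theorem BoxMerging_biUnion_stateEvent_exists {Ω κ : Type*} [Fintype κ] [DecidableEq κ]
    (C : κ → κ → Set Ω) (I J : Finset κ) :
    (⋃ M ∈ (Finset.univ.filter fun M : κ → κ → Bool => ∃ a ∈ I, ∃ b ∈ J, M a b = true),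
      {ω | ∀ a b, ω ∈ C a b ↔ M a b = true}) = ⋃ a ∈ I, ⋃ b ∈ J, C a b := by
  classical
  ext ω
  simp only [mem_iUnion, Finset.mem_filter, Finset.mem_univ, true_and, mem_setOf_eq, exists_prop]
  constructor
  · rintro ⟨M, ⟨a, ha, b, hb, hM⟩, h⟩
    exact ⟨a, ha, b, hb, (h a b).2 hM⟩
  · rintro ⟨a, ha, b, hb, hω⟩
    exact ⟨fun a b => decide (ω ∈ C a b), ⟨a, ha, b, hb, decide_eq_true hω⟩, fun a b => by simp⟩

/-- **Transfer for unions of crossing events.**  For a bounded window `Ω`, a finite family `A`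
of boundary pieces, index sets `I, J`, a `ℤ²`-mesh `u` and a `𝕋`-mesh `u' > 0`, the
probabilities of `⋃_{(a,b) ∈ I × J} {A a ↔ A b}` on the two lattices differ by at most
`Σ_M |P_ℤ²[E_Z M] - P_𝕋[E_T M]|`. [folklore] -/
theorem BoxMerging_abs_bond_sub_tri_biUnion_le {Ω : Set ℂ} (hΩ : Bornology.IsBounded Ω)
    {κ : Type*} [Fintype κ] [DecidableEq κ] (A : κ → Set ℂ) (I J : Finset κ) (u : ℝ) {u' : ℝ}
    (hu' : 0 < u') :
    |(bondPercolation (zdGraph 2) half).real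
          (⋃ a ∈ I, ⋃ b ∈ J, discreteCrossing Ω u (A a) (A b)) -
        (triSitePercolation half).real (⋃ a ∈ I, ⋃ b ∈ J, triCrossing Ω u' (A a) (A b))| ≤
      ∑ M : κ → κ → Bool,
        |(bondPercolation (zdGraph 2) half).real
            {ω | ∀ a b, ω ∈ discreteCrossing Ω u (A a) (A b) ↔ M a b = true} -
          (triSitePercolation half).real
            {ω | ∀ a b, ω ∈ triCrossing Ω u' (A a) (A b) ↔ M a b = true}| := by
  have e1 : (⋃ a ∈ I, ⋃ b ∈ J, discreteCrossing Ω u (A a) (A b)) =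
      ⋃ M ∈ (Finset.univ.filter fun M : κ → κ → Bool => ∃ a ∈ I, ∃ b ∈ J, M a b = true),
        {ω | ∀ a b, ω ∈ discreteCrossing Ω u (A a) (A b) ↔ M a b = true} :=
    (BoxMerging_biUnion_stateEvent_exists (fun a b => discreteCrossing Ω u (A a) (A b)) I J).symm
  have e2 : (⋃ a ∈ I, ⋃ b ∈ J, triCrossing Ω u' (A a) (A b)) =
      ⋃ M ∈ (Finset.univ.filter fun M : κ → κ → Bool => ∃ a ∈ I, ∃ b ∈ J, M a b = true),
        {ω | ∀ a b, ω ∈ triCrossing Ω u' (A a) (A b) ↔ M a b = true} :=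
    (BoxMerging_biUnion_stateEvent_exists (fun a b => triCrossing Ω u' (A a) (A b)) I J).symm
  rw [e1, e2]
  exact BoxMerging_abs_measureReal_biUnion_sub_le _ _
    (BoxMerging_pairwise_disjoint_stateEvent fun a b => discreteCrossing Ω u (A a) (A b))
    (BoxMerging_pairwise_disjoint_stateEvent fun a b => triCrossing Ω u' (A a) (A b))
    (BoxMerging_measurableSet_stateEvent _ fun a b => measurableSet_discreteCrossing Ω u (A a) (A b))
    (BoxMerging_measurableSet_stateEvent _ fun a b =>
      BoxMerging_measurableSet_triCrossing hΩ hu' (A a) (A b)) _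

/-- **Crossing probabilities between unions of boundary pieces are read from the state law, on
both lattices.**  For a bounded window `Ω`, a finite family `A` of nonempty boundary pieces,
nonempty index sets `I, J` each leaving out a nonempty part of `∂Ω`, a `ℤ²`-mesh `u` and a
`𝕋`-mesh `u' > 0`:
`|P_ℤ²[discreteCrossing Ω u (⋃_I A) (⋃_J A)] - P_𝕋[triCrossing Ω u' (⋃_I A) (⋃_J A)]|`
`≤ Σ_M |P_ℤ²[E_Z M] - P_𝕋[E_T M]|` (twice the total variation of the two state laws).
[folklore] -/
theorem BoxMerging_abs_bond_sub_tri_le_of_biUnion {Ω : Set ℂ} (hΩ : Bornology.IsBounded Ω)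
    {κ : Type*} [Fintype κ] [DecidableEq κ] (A : κ → Set ℂ) (hA : ∀ a, (A a).Nonempty)
    {I J : Finset κ} (hI : I.Nonempty) (hJ : J.Nonempty)
    (hFI : (frontier Ω \ ⋃ a ∈ I, A a).Nonempty) (hFJ : (frontier Ω \ ⋃ b ∈ J, A b).Nonempty)
    (u : ℝ) {u' : ℝ} (hu' : 0 < u') :
    |(bondPercolation (zdGraph 2) half).real
          (discreteCrossing Ω u (⋃ a ∈ I, A a) (⋃ b ∈ J, A b)) -
        (triSitePercolation half).real (triCrossing Ω u' (⋃ a ∈ I, A a) (⋃ b ∈ J, A b))| ≤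
      ∑ M : κ → κ → Bool,
        |(bondPercolation (zdGraph 2) half).real
            {ω | ∀ a b, ω ∈ discreteCrossing Ω u (A a) (A b) ↔ M a b = true} -
          (triSitePercolation half).real
            {ω | ∀ a b, ω ∈ triCrossing Ω u' (A a) (A b) ↔ M a b = true}| := by
  rw [BoxMerging_discreteCrossing_biUnion A hI hJ hA hFI hFJ,
    BoxMerging_triCrossing_biUnion A hI hJ hA hFI hFJ]
  exact BoxMerging_abs_bond_sub_tri_biUnion_le hΩ A I J u hu'

end Summit.CriticalPhenomena.CardyFormulaZ2.Theorems
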